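import Mathlib.MeasureTheory.Measure.Haar.InnerProductSpace
import Mathlib.MeasureTheory.Group.Measure
import Mathlib.LinearAlgebra.Matrix.AbsoluteValue
import Mathlib.LinearAlgebra.Matrix.BilinearForm
import Literature.Geometry.Symplectic.GromovR4RelEndProofs
import Literature.Geometry.Kaehler.ManifoldFormsChart

/-!
# The end does not return — the symplectic volume count (helper for stub
`stub_endDoesNotReturn`, line `cross-cap-laurent`, crux `SymplecticOrigami.GromovRecognitionRelEnd`
≡ `SymplecticCap.GromovRecognitionRelEnd`, item stmt-SmoothPoincare4-11009; second of three files)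

The topological dichotomy of the first file reduces the stub "every truncation
`K ∪ {x ∈ Kᶜ | ‖ψ x‖ < R'}` is open" to `¬ CompactSpace M`, and the refuter's `S⁴` model
(`Disproof.lean` §11) shows that this needs the symplectic form: here we prove the LOCAL half of
the volume count, from `IsSmoothForm sf` (H2), the end chart `ψ, χ` (H6–H9) and the pull-back
clause `sf = ψ*ω₀` on `Kᶜ` (H10):

* `one_le_mul_det_sq`, `det_lower_bound` — LINEAR ALGEBRA: if `ω₀(a, b) = β(P a, P b)` for a
  `2`-form `β` on `ℝ⁴` with `‖β‖ ≤ C` and a linear `P`, then `1 ≤ 24 C⁴ (det P)²`, hence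
  `|det P| ≥ 1 / (1 + 24 C⁴)` (matrices in the standard basis: `Ω₀ = Pᵀ B P`, `det Ω₀ = 1`,
  `|det B| ≤ 4! C⁴` by `Matrix.det_le`);
* `std_eq_inChart_mfderiv` — CHART CALCULUS: for `w` in the end with `χ w` in the source of the
  chart `e` at `p`, `ω₀(a, b) = (sf.inChart p)(e (χ w)) (D(e ∘ χ)_w a, D(e ∘ χ)_w b)` (H10 at
  `χ w` and the chain rule for `ψ ∘ e⁻¹ ∘ e ∘ χ = id` near `w`);
* `exists_nhds_volume_lt_top` — every `p : M` has an open neighbourhood `U` such that the piece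
  `{w | R < ‖w‖, χ w ∈ U}` of the end has FINITE Lebesgue measure: the chart representative of
  the smooth `sf` is bounded by `C` on a chart ball around `p`, so `F = e ∘ χ` is injective and
  differentiable on the piece with `|det DF| ≥ 1 / (1 + 24 C⁴)`, and Mathlib's change of
  variables `MeasureTheory.lintegral_abs_det_fderiv_le_addHaar_image` bounds `c · vol(piece)`
  by the volume of the chart ball;
* `volume_compl_closedBall_eq_top` — the end `{R < ‖w‖}` itself has infinite measure.

The third file combines: `M` compact ⇒ finitely many `U` cover `M` ⇒ the end has finite measure,
contradiction; then the dichotomy gives the stub. The model space is written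
`EuclideanSpace ℝ (Fin 4)` and its model with corners `𝓡 4` (`= 𝓘(ℝ, ℝ⁴)`) throughout (no local
notation).

References: D. McDuff, D. Salamon, *Introduction to Symplectic Topology*, 3rd ed. (2017),
Rem. 4.5.2 (viii) and §1.1 [McDuffSalamon2017]; J. M. Lee, *Introduction to Smooth Manifolds*
(2013), Lemma 14.16 (chart representatives) [LeeSmoothManifolds2013].
-/

noncomputable section

-- the prescribed namespace `Summit.<P>.<Sub>.…` duplicates `SmoothPoincare4` (P = Sub)
set_option linter.dupNamespace false

open scoped Manifold ContDiff Topology Matrix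
open Set TopologicalSpace Literature.Geometry.Kaehler Literature.Geometry.Symplectic

namespace Summit.SmoothPoincare4.SmoothPoincare4.Theorems.GromovRecognitionRelEnd.CrossCapLaurent

/-! ## Linear algebra: a bounded `2`-form pulling back to `ω₀` forces `|det| ≥ c` -/

/-- **Determinant bound.** If `ω₀(a, b) = β(P a, P b)` for all `a b : ℝ⁴`, where `β` is a
continuous alternating `2`-form with `‖β‖ ≤ C` and `P : ℝ⁴ →L ℝ⁴`, then `1 ≤ 24 · C⁴ · (det P)²`.
(In the standard orthonormal basis the Gram matrices satisfy `Ω₀ = Pᵀ B P`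
(`LinearMap.BilinForm.toMatrix_comp`), `det Ω₀ = 1`, and `|det B| ≤ 4! · C⁴` by `Matrix.det_le`
since `|B i j| = |β(e i, e j)| ≤ ‖β‖`.) [folklore] -/
theorem one_le_mul_det_sq (β : (EuclideanSpace ℝ (Fin 4)) [⋀^Fin 2]→L[ℝ] ℝ)
    (P : EuclideanSpace ℝ (Fin 4) →L[ℝ] EuclideanSpace ℝ (Fin 4)) {C : ℝ} (hC : ‖β‖ ≤ C)
    (h : ∀ a b, stdSymplecticForm a b = β ![P a, P b]) :
    1 ≤ 24 * C ^ 4 * P.det ^ 2 := by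
  classical
  obtain ⟨B, -, hB⟩ := exists_bilinForm_eq_twoForm β
  obtain ⟨Ω, -, hΩ⟩ := exists_bilinForm_eq_twoForm stdSymplecticAlt
  set bs : Module.Basis (Fin 4) ℝ (EuclideanSpace ℝ (Fin 4)) :=
    (EuclideanSpace.basisFun (Fin 4) ℝ).toBasis with hbs
  have hbs_apply : ∀ i, bs i = EuclideanSpace.single i (1 : ℝ) := fun i => by
    simp [hbs]
  set Pl : EuclideanSpace ℝ (Fin 4) →ₗ[ℝ] EuclideanSpace ℝ (Fin 4) :=
    (↑P : EuclideanSpace ℝ (Fin 4) →ₗ[ℝ] EuclideanSpace ℝ (Fin 4)) with hPl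
  have hcomp : B.comp Pl Pl = Ω := by
    refine LinearMap.ext fun a => LinearMap.ext fun b => ?_
    rw [LinearMap.BilinForm.comp_apply, hB, hΩ, stdSymplecticAlt_apply, h]
    rfl
  have hmat : LinearMap.BilinForm.toMatrix bs Ω =
      (LinearMap.toMatrix bs bs Pl)ᵀ * LinearMap.BilinForm.toMatrix bs B *
        LinearMap.toMatrix bs bs Pl := by
    rw [← hcomp]
    exact LinearMap.BilinForm.toMatrix_comp bs bs B _ _
  have hdet : (LinearMap.BilinForm.toMatrix bs Ω).det =
      P.det ^ 2 * (LinearMap.BilinForm.toMatrix bs B).det := by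
    rw [hmat, Matrix.det_mul, Matrix.det_mul, Matrix.det_transpose, LinearMap.det_toMatrix]
    simp only [ContinuousLinearMap.det, hPl]
    ring
  have hΩdet : (LinearMap.BilinForm.toMatrix bs Ω).det = 1 := by
    have hM : LinearMap.BilinForm.toMatrix bs Ω =
        !![0, 1, 0, 0; -1, 0, 0, 0; 0, 0, 0, 1; 0, 0, -1, 0] := by
      ext i j
      rw [LinearMap.BilinForm.toMatrix_apply, hΩ, stdSymplecticAlt_apply, hbs_apply, hbs_apply]
      fin_cases i <;> fin_cases j <;> simp [stdSymplecticForm]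
    rw [hM, Matrix.det_succ_row_zero]
    simp [Fin.sum_univ_succ, Matrix.det_fin_three, Fin.succAbove]
  have hentry : ∀ i j, AbsoluteValue.abs (LinearMap.BilinForm.toMatrix bs B i j) ≤ C := by
    intro i j
    rw [AbsoluteValue.abs_apply, LinearMap.BilinForm.toMatrix_apply, hB]
    calc |β ![bs i, bs j]| = ‖β ![bs i, bs j]‖ := (Real.norm_eq_abs _).symm
      _ ≤ ‖β‖ * ∏ k, ‖(![bs i, bs j] : Fin 2 → EuclideanSpace ℝ (Fin 4)) k‖ := β.le_opNorm _
      _ = ‖β‖ := by simp [Fin.prod_univ_two, hbs_apply]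
      _ ≤ C := hC
  have hBdet : |(LinearMap.BilinForm.toMatrix bs B).det| ≤ 24 * C ^ 4 := by
    have := Matrix.det_le hentry
    rw [AbsoluteValue.abs_apply] at this
    simpa [Nat.factorial] using this
  calc (1 : ℝ) = |(LinearMap.BilinForm.toMatrix bs Ω).det| := by rw [hΩdet, abs_one]
    _ = P.det ^ 2 * |(LinearMap.BilinForm.toMatrix bs B).det| := by
        rw [hdet, abs_mul, abs_pow, sq_abs]
    _ ≤ P.det ^ 2 * (24 * C ^ 4) := mul_le_mul_of_nonneg_left hBdet (sq_nonneg _)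
    _ = 24 * C ^ 4 * P.det ^ 2 := by ring

/-- **Determinant bound, usable form**: under the hypotheses of `one_le_mul_det_sq`,
`1 / (1 + 24 C⁴) ≤ |det P|` (if `|det P| < 1` then `(det P)² ≤ |det P|`). [folklore] -/
theorem det_lower_bound (β : (EuclideanSpace ℝ (Fin 4)) [⋀^Fin 2]→L[ℝ] ℝ)
    (P : EuclideanSpace ℝ (Fin 4) →L[ℝ] EuclideanSpace ℝ (Fin 4)) {C : ℝ} (hC : ‖β‖ ≤ C)
    (h : ∀ a b, stdSymplecticForm a b = β ![P a, P b]) :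
    1 / (1 + 24 * C ^ 4) ≤ |P.det| := by
  have h1 := one_le_mul_det_sq β P hC h
  have hC4 : 0 ≤ 24 * C ^ 4 := by positivity
  rw [div_le_iff₀ (by positivity)]
  by_cases hd : 1 ≤ |P.det|
  · nlinarith [abs_nonneg P.det]
  · have hd' : |P.det| < 1 := not_le.1 hd
    have h2 : P.det ^ 2 ≤ |P.det| := by
      rw [← sq_abs]
      nlinarith [abs_nonneg P.det]
    nlinarith [abs_nonneg P.det]

/-! ## Chart calculus: the pull-back clause read in a chart -/

/-- Mapping a function over a pair of vectors: `(f (![u, v] i))ᵢ = ![f u, f v]`. [folklore] -/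
theorem comp_vec2 {α β : Type*} (f : α → β) (u v : α) :
    (fun i => f (![u, v] i)) = ![f u, f v] := by
  funext i
  fin_cases i <;> rfl

variable {M : Type} [TopologicalSpace M] [ChartedSpace (EuclideanSpace ℝ (Fin 4)) M]
  [IsManifold (𝓡 4) ∞ M]

/-- **The pull-back clause in a chart.** Let `K` be closed, `ψ` smooth on `Kᶜ`, `χ` smooth on
the end `T = {R < ‖z‖}`, `ψ : Kᶜ → T` bijective with `χ ∘ ψ = id` on `Kᶜ`, and `sf = ψ*ω₀` on
`Kᶜ` (`mfderiv` form). For `w ∈ T` with `χ w` in the source of the extended chart `e` at `p`,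
and `F = e ∘ χ : ℝ⁴ → ℝ⁴`, the chart representative of `sf` at `e (χ w)` pulls back to `ω₀`
along `DF_w`: `ω₀(a, b) = (sf.inChart p)(e (χ w)) (DF_w a, DF_w b)`. Proof: the representative
is `sf (χ w) ∘ D(e⁻¹)` (definition of `MForm.inChart`), H10 turns `sf (χ w)` into `ω₀ ∘ Dψ`, and
`Dψ ∘ D(e⁻¹) ∘ DF = D(ψ ∘ e⁻¹ ∘ e ∘ χ) = D(id)` near `w` by the chain rule (`mfderiv_comp`).
[cite: LeeSmoothManifolds2013, Lemma 14.16] -/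
theorem std_eq_inChart_mfderiv (sf : MForm (𝓡 4) M ℝ 2) (K : Set M) (R : ℝ)
    (ψ : M → EuclideanSpace ℝ (Fin 4)) (χ : EuclideanSpace ℝ (Fin 4) → M) (hK : IsClosed K)
    (h6 : ContMDiffOn (𝓡 4) (𝓡 4) ∞ ψ Kᶜ)
    (h7 : ContMDiffOn (𝓡 4) (𝓡 4) ∞ χ (Metric.closedBall (0 : EuclideanSpace ℝ (Fin 4)) R)ᶜ)
    (h8 : Set.BijOn ψ Kᶜ (Metric.closedBall (0 : EuclideanSpace ℝ (Fin 4)) R)ᶜ)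
    (h9 : ∀ x, x ∈ Kᶜ → χ (ψ x) = x)
    (h10 : ∀ x, x ∈ Kᶜ → ∀ v w, sf x ![v, w] =
      stdSymplecticForm (mfderiv (𝓡 4) (𝓡 4) ψ x v) (mfderiv (𝓡 4) (𝓡 4) ψ x w))
    (p : M) {w : EuclideanSpace ℝ (Fin 4)}
    (hw : w ∈ (Metric.closedBall (0 : EuclideanSpace ℝ (Fin 4)) R)ᶜ)
    (hwp : χ w ∈ (extChartAt (𝓡 4) p).source) (a b : EuclideanSpace ℝ (Fin 4)) :
    stdSymplecticForm a b =
      sf.inChart p (extChartAt (𝓡 4) p (χ w))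
        ![mfderiv (𝓡 4) (𝓡 4) (extChartAt (𝓡 4) p ∘ χ) w a,
          mfderiv (𝓡 4) (𝓡 4) (extChartAt (𝓡 4) p ∘ χ) w b] := by
  set e := extChartAt (𝓡 4) p with he
  set T : Set (EuclideanSpace ℝ (Fin 4)) :=
    (Metric.closedBall (0 : EuclideanSpace ℝ (Fin 4)) R)ᶜ with hT
  have hTo : IsOpen T := Metric.isClosed_closedBall.isOpen_compl
  have hKo : IsOpen Kᶜ := hK.isOpen_compl
  have hright : ∀ z, z ∈ T → χ z ∈ Kᶜ ∧ ψ (χ z) = z := by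
    intro z hz
    obtain ⟨x, hx, rfl⟩ := h8.surjOn hz
    rw [h9 x hx]
    exact ⟨hx, rfl⟩
  set F : EuclideanSpace ℝ (Fin 4) → EuclideanSpace ℝ (Fin 4) := e ∘ χ with hF
  -- differentiability of the pieces
  have hχw : MDifferentiableAt (𝓡 4) (𝓡 4) χ w :=
    (h7.contMDiffAt (hTo.mem_nhds hw)).mdifferentiableAt (by simp)
  have hew : MDifferentiableAt (𝓡 4) (𝓡 4) e (χ w) :=
    mdifferentiableAt_extChartAt (by rwa [← extChartAt_source (𝓡 4)])
  have hFw : MDifferentiableAt (𝓡 4) (𝓡 4) F w := hew.comp w hχw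
  have hFt : F w ∈ e.target := e.map_source hwp
  have hx' : e.symm (F w) = χ w := e.left_inv hwp
  have hx'K : e.symm (F w) ∈ Kᶜ := by
    rw [hx']
    exact (hright w hw).1
  have hψ : MDifferentiableAt (𝓡 4) (𝓡 4) ψ (e.symm (F w)) :=
    (h6.contMDiffAt (hKo.mem_nhds hx'K)).mdifferentiableAt (by simp)
  have hsymm : MDifferentiableAt (𝓡 4) (𝓡 4) e.symm (F w) := by
    have h := mdifferentiableWithinAt_extChartAt_symm hFt
    rwa [ModelWithCorners.range_eq_univ, mdifferentiableWithinAt_univ] at h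
  -- chain rule for `ψ ∘ e⁻¹ ∘ F = id` near `w`
  have hc1 : mfderiv (𝓡 4) (𝓡 4) (ψ ∘ e.symm) (F w) =
      (mfderiv (𝓡 4) (𝓡 4) ψ (e.symm (F w))).comp (mfderiv (𝓡 4) (𝓡 4) e.symm (F w)) :=
    mfderiv_comp (F w) hψ hsymm
  have hc2 : mfderiv (𝓡 4) (𝓡 4) ((ψ ∘ e.symm) ∘ F) w =
      (mfderiv (𝓡 4) (𝓡 4) (ψ ∘ e.symm) (F w)).comp (mfderiv (𝓡 4) (𝓡 4) F w) :=
    mfderiv_comp w (hψ.comp (F w) hsymm) hFw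
  have hid : ((ψ ∘ e.symm) ∘ F) =ᶠ[𝓝 w] id := by
    have hO : IsOpen (T ∩ χ ⁻¹' e.source) :=
      h7.continuousOn.isOpen_inter_preimage hTo (isOpen_extChartAt_source p)
    filter_upwards [hO.mem_nhds ⟨hw, hwp⟩] with z hz
    show ψ (e.symm (e (χ z))) = z
    rw [e.left_inv hz.2, (hright z hz.1).2]
  have hc3 : mfderiv (𝓡 4) (𝓡 4) ((ψ ∘ e.symm) ∘ F) w =
      ContinuousLinearMap.id ℝ (TangentSpace (𝓡 4) w) := by
    rw [hid.mfderiv_eq, mfderiv_id]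
  have key : ∀ v : EuclideanSpace ℝ (Fin 4), mfderiv (𝓡 4) (𝓡 4) ψ (e.symm (F w))
      (mfderiv (𝓡 4) (𝓡 4) e.symm (F w) (mfderiv (𝓡 4) (𝓡 4) F w v)) = v := by
    intro v
    have h1 := congrArg (fun L : TangentSpace (𝓡 4) w →L[ℝ] TangentSpace (𝓡 4) w => L v)
      (hc2.symm.trans hc3)
    rw [hc1] at h1
    exact h1
  have hD : mfderivWithin (𝓡 4) (𝓡 4) e.symm (range (𝓡 4)) (F w) =
      mfderiv (𝓡 4) (𝓡 4) e.symm (F w) := by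
    rw [ModelWithCorners.range_eq_univ, mfderivWithin_univ]
  -- main computation
  show stdSymplecticForm a b =
    sf.inChart p (F w) ![mfderiv (𝓡 4) (𝓡 4) F w a, mfderiv (𝓡 4) (𝓡 4) F w b]
  rw [MForm.inChart_apply, comp_vec2, hD, h10 _ hx'K, key, key]

/-! ## The local volume count -/

open MeasureTheory in
/-- **Local finiteness of the end volume.** Under H2 (`sf` smooth), `K` closed, H6–H9 (the end
chart `ψ : Kᶜ ≃ {R < ‖z‖}` with inverse `χ`) and H10 (`sf = ψ*ω₀` on `Kᶜ`), every point `p : M`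
has an open neighbourhood `U` such that the piece `{w | R < ‖w‖ ∧ χ w ∈ U}` of the end has
finite Lebesgue measure. Proof: the chart representative `α = sf.inChart p` is continuous on the
chart target (`IsSmoothForm.contDiffOn_inChart`), so `‖α‖ ≤ C` on a ball `B` around the chart
centre; `U` is the preimage of `B`; on the (open) piece `S`, `F = e ∘ χ` is injective,
differentiable, maps into `B`, and `|det DF| ≥ c = 1/(1 + 24C⁴)` (`det_lower_bound` with
`std_eq_inChart_mfderiv`); hence `c · vol S ≤ ∫_S |det DF| ≤ vol (F '' S) ≤ vol B < ∞` by
`MeasureTheory.lintegral_abs_det_fderiv_le_addHaar_image`. [folklore] -/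
theorem exists_nhds_volume_lt_top (sf : MForm (𝓡 4) M ℝ 2) (K : Set M) (R : ℝ)
    (ψ : M → EuclideanSpace ℝ (Fin 4)) (χ : EuclideanSpace ℝ (Fin 4) → M)
    (h2 : IsSmoothForm sf) (hK : IsClosed K)
    (h6 : ContMDiffOn (𝓡 4) (𝓡 4) ∞ ψ Kᶜ)
    (h7 : ContMDiffOn (𝓡 4) (𝓡 4) ∞ χ (Metric.closedBall (0 : EuclideanSpace ℝ (Fin 4)) R)ᶜ)
    (h8 : Set.BijOn ψ Kᶜ (Metric.closedBall (0 : EuclideanSpace ℝ (Fin 4)) R)ᶜ)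
    (h9 : ∀ x, x ∈ Kᶜ → χ (ψ x) = x)
    (h10 : ∀ x, x ∈ Kᶜ → ∀ v w, sf x ![v, w] =
      stdSymplecticForm (mfderiv (𝓡 4) (𝓡 4) ψ x v) (mfderiv (𝓡 4) (𝓡 4) ψ x w))
    (p : M) :
    ∃ U : Set M, IsOpen U ∧ p ∈ U ∧
      volume {w : EuclideanSpace ℝ (Fin 4) |
        w ∈ (Metric.closedBall (0 : EuclideanSpace ℝ (Fin 4)) R)ᶜ ∧ χ w ∈ U} < ⊤ := by
  set e := extChartAt (𝓡 4) p with he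
  set T : Set (EuclideanSpace ℝ (Fin 4)) :=
    (Metric.closedBall (0 : EuclideanSpace ℝ (Fin 4)) R)ᶜ with hT
  have hTo : IsOpen T := Metric.isClosed_closedBall.isOpen_compl
  have hright : ∀ z, z ∈ T → χ z ∈ Kᶜ ∧ ψ (χ z) = z := by
    intro z hz
    obtain ⟨x, hx, rfl⟩ := h8.surjOn hz
    rw [h9 x hx]
    exact ⟨hx, rfl⟩
  -- (a) the chart representative `α` of `sf` is bounded near `e p`
  set α := sf.inChart p with hα
  have hcont : ContinuousAt α (e p) :=
    (h2.contDiffOn_inChart p).continuousOn.continuousAt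
      ((isOpen_extChartAt_target p).mem_nhds (mem_extChartAt_target p))
  set C : ℝ := ‖α (e p)‖ + 1 with hC
  obtain ⟨r, hr0, hrC⟩ : ∃ r > 0, ∀ y ∈ Metric.ball (e p) r, ‖α y‖ ≤ C := by
    have h2' : ∀ᶠ y in 𝓝 (e p), ‖α y‖ < C :=
      hcont.norm.eventually_lt continuousAt_const (by rw [hC]; linarith)
    obtain ⟨r, hr0, hr⟩ := Metric.eventually_nhds_iff_ball.1 h2'
    exact ⟨r, hr0, fun y hy => (hr y hy).le⟩
  -- (b) the neighbourhood `U` and the piece `S` of the end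
  set U : Set M := e.source ∩ e ⁻¹' Metric.ball (e p) r with hU
  have hUo : IsOpen U := isOpen_extChartAt_preimage' p Metric.isOpen_ball
  refine ⟨U, hUo, ⟨mem_extChartAt_source p, Metric.mem_ball_self hr0⟩, ?_⟩
  set S : Set (EuclideanSpace ℝ (Fin 4)) := {w | w ∈ T ∧ χ w ∈ U} with hS
  have hSo : IsOpen S := h7.continuousOn.isOpen_inter_preimage hTo hUo
  set F : EuclideanSpace ℝ (Fin 4) → EuclideanSpace ℝ (Fin 4) := e ∘ χ with hF
  -- (c) `F` is injective on `S` and maps it into the ball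
  have hinj : InjOn F S := by
    intro w₁ hw₁ w₂ hw₂ hEq
    have h1 : χ w₁ = χ w₂ := e.injOn hw₁.2.1 hw₂.2.1 hEq
    rw [← (hright w₁ hw₁.1).2, ← (hright w₂ hw₂.1).2, h1]
  have hmaps : F '' S ⊆ Metric.ball (e p) r := by
    rintro _ ⟨w, hw, rfl⟩
    exact hw.2.2
  -- (d) `F` is differentiable on `S`, with Jacobian bounded below
  have hdiff : ∀ w ∈ S, HasFDerivWithinAt F (fderiv ℝ F w) S w := by
    intro w hw
    have hχw : MDifferentiableAt (𝓡 4) (𝓡 4) χ w :=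
      (h7.contMDiffAt (hTo.mem_nhds hw.1)).mdifferentiableAt (by simp)
    have hew : MDifferentiableAt (𝓡 4) (𝓡 4) e (χ w) :=
      mdifferentiableAt_extChartAt (by rw [← extChartAt_source (𝓡 4)]; exact hw.2.1)
    have hFw : DifferentiableAt ℝ F w :=
      mdifferentiableAt_iff_differentiableAt.1 (hew.comp w hχw)
    exact hFw.hasFDerivAt.hasFDerivWithinAt
  set c : ℝ := 1 / (1 + 24 * C ^ 4) with hc
  have hc0 : 0 < c := by positivity
  have hjac : ∀ w ∈ S, c ≤ |(fderiv ℝ F w).det| := by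
    intro w hw
    have hP : (mfderiv (𝓡 4) (𝓡 4) F w :
        EuclideanSpace ℝ (Fin 4) →L[ℝ] EuclideanSpace ℝ (Fin 4)) = fderiv ℝ F w :=
      mfderiv_eq_fderiv
    rw [← hP]
    exact det_lower_bound (α (F w)) _ (hrC _ hw.2.2) fun a b =>
      std_eq_inChart_mfderiv sf K R ψ χ hK h6 h7 h8 h9 h10 p hw.1 hw.2.1 a b
  -- (e) change of variables: `c · vol S ≤ vol (F '' S) ≤ vol (ball) < ∞`
  have hle : ENNReal.ofReal c * volume S ≤ volume (Metric.ball (e p) r) :=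
    calc ENNReal.ofReal c * volume S = ∫⁻ _ in S, ENNReal.ofReal c ∂volume :=
          (setLIntegral_const _ _).symm
      _ ≤ ∫⁻ w in S, ENNReal.ofReal |(fderiv ℝ F w).det| ∂volume :=
          setLIntegral_mono' hSo.measurableSet fun w hw => ENNReal.ofReal_le_ofReal (hjac w hw)
      _ ≤ volume (F '' S) :=
          lintegral_abs_det_fderiv_le_addHaar_image volume hSo.measurableSet hdiff hinj
      _ ≤ volume (Metric.ball (e p) r) := measure_mono hmaps
  have hprod : ENNReal.ofReal c * volume S ≠ ⊤ := (hle.trans_lt measure_ball_lt_top).ne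
  exact ENNReal.lt_top_of_mul_ne_top_right hprod (ENNReal.ofReal_pos.2 hc0).ne'

open MeasureTheory in
/-- The standard end `{R < ‖w‖}` of `ℝ⁴` has infinite Lebesgue measure (its complement, a closed
ball, has finite measure while `ℝ⁴` has infinite measure). [folklore] -/
theorem volume_compl_closedBall_eq_top (R : ℝ) :
    volume (Metric.closedBall (0 : EuclideanSpace ℝ (Fin 4)) R)ᶜ = ⊤ := by
  have huniv : volume (univ : Set (EuclideanSpace ℝ (Fin 4))) = ⊤ :=
    measure_univ_of_isAddLeftInvariant volume
  by_contra h
  have hfin : volume ((Metric.closedBall (0 : EuclideanSpace ℝ (Fin 4)) R)ᶜ ∪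
      Metric.closedBall (0 : EuclideanSpace ℝ (Fin 4)) R) < ⊤ :=
    (measure_union_le _ _).trans_lt
      (ENNReal.add_lt_top.2 ⟨lt_top_iff_ne_top.2 h, measure_closedBall_lt_top⟩)
  rw [compl_union_self] at hfin
  exact absurd huniv hfin.ne

/-! ## Registered helper sub-goal -/

/-- **Registered helper sub-goal `helper_endPieceFiniteVolume`** (the local volume count
`exists_nhds_volume_lt_top` in closed form): under H2, `K` closed, H6–H10, every point of `M` has
an open neighbourhood `U` whose end-piece `{w | R < ‖w‖ ∧ χ w ∈ U}` has finite Lebesgue measure.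
[folklore] -/
theorem helper_endPieceFiniteVolume : ∀ (M : Type) [TopologicalSpace M]
    [ChartedSpace (EuclideanSpace ℝ (Fin 4)) M] [IsManifold (𝓡 4) ∞ M]
    (sf : Literature.Geometry.Kaehler.MForm (𝓡 4) M ℝ 2) (K : Set M) (R : ℝ)
    (ψ : M → EuclideanSpace ℝ (Fin 4)) (χ : EuclideanSpace ℝ (Fin 4) → M),
    Literature.Geometry.Kaehler.IsSmoothForm sf → IsClosed K →
    ContMDiffOn (𝓡 4) (𝓡 4) ∞ ψ Kᶜ →
    ContMDiffOn (𝓡 4) (𝓡 4) ∞ χ (Metric.closedBall (0 : EuclideanSpace ℝ (Fin 4)) R)ᶜ →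
    Set.BijOn ψ Kᶜ (Metric.closedBall (0 : EuclideanSpace ℝ (Fin 4)) R)ᶜ →
    (∀ x, x ∈ Kᶜ → χ (ψ x) = x) →
    (∀ x, x ∈ Kᶜ → ∀ v w, sf x ![v, w] =
      Literature.Geometry.Symplectic.stdSymplecticForm (mfderiv (𝓡 4) (𝓡 4) ψ x v)
        (mfderiv (𝓡 4) (𝓡 4) ψ x w)) →
    ∀ p : M, ∃ U : Set M, IsOpen U ∧ p ∈ U ∧
      MeasureTheory.volume {w : EuclideanSpace ℝ (Fin 4) |
        w ∈ (Metric.closedBall (0 : EuclideanSpace ℝ (Fin 4)) R)ᶜ ∧ χ w ∈ U} < ⊤ :=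
  fun _ _ _ _ sf K R ψ χ h2 hK h6 h7 h8 h9 h10 p =>
    exists_nhds_volume_lt_top sf K R ψ χ h2 hK h6 h7 h8 h9 h10 p

end Summit.SmoothPoincare4.SmoothPoincare4.Theorems.GromovRecognitionRelEnd.CrossCapLaurent

end
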